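import Literature.Probability.LatticeModels.UrsellInversion
import HarnessLib

/-!
# Multilinearity of the Ursell (truncated) function in one argument

Topic `Literature/Probability/LatticeModels`; a companion of `UrsellInversion.lean`.  The truncated
expectations `𝓔ᵀ(X₁, …, X_s)` of commuting variables are MULTILINEAR in their arguments (Ruelle 1969,
§4.4.2; Mastropietro 2008, §2.3 after (2.38); Benfatto–Giuliani–Mastropietro 2006, (2.31): the effective
potential `Σₙ (1/n!) 𝓔ᵀ(𝒱; n)` is expanded by multilinearity into the truncated expectations of the
monomials of `𝒱`).  In the language of `ursellOf` (Möbius inversion of a "moment" function `m` on the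
finite subsets of `α`) the arguments are implicit, so linearity in the argument `u : α` is stated for a
moment function `m` that is a linear combination `m(P) = Σ_k w_k m_k(P)` on the sets `P ∋ u` of moment
functions `m_k` agreeing with `m` on the sets `P ∌ u` (as happens for `m(P) = 𝓔(∏_{i ∈ P} Xᵢ)` when
`X_u = Σ_k w_k X_u^{(k)}` and `m_k` uses `X_u^{(k)}`):

* `ursellOf_eq_of_forall_not_mem` — a moment function modified only on sets containing `u` has the same
  Ursell function on the sets not containing `u`;
* **`ursellOf_eq_sum_mul_of_linear`** — `mᵀ(W) = Σ_k w_k m_kᵀ(W)` for every `W ∋ u`;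
* `ursellOf_eq_add_of_linear`, `ursellOf_eq_mul_of_linear` — the additive and homogeneous cases.

Everything is proved; no named fact.

## Sources

D. Ruelle, *Statistical Mechanics: Rigorous Results* (1969), §4.4.1–4.4.2 (`Ruelle1969`);
V. Mastropietro, *Non-Perturbative Renormalization* (2008), §2.3 (2.32)–(2.38) (`Mastropietro2008`);
G. Benfatto, A. Giuliani, V. Mastropietro, Ann. Henri Poincaré 7 (2006), (2.14), (2.31)
(`BenfattoGiulianiMastropietro2006`).
-/

open Finset

namespace Literature.Probability.LatticeModels

variable {α : Type*} [DecidableEq α] {C : Type*} [CommRing C]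

/-- **Locality of the Möbius inversion**: if two moment functions agree on the sets not containing `u`,
so do their Ursell functions. [cite: Ruelle1969, §4.4.1 (4.5)-(4.7)] -/
theorem ursellOf_eq_of_forall_not_mem (m m' : Finset α → C) (u : α)
    (h : ∀ P : Finset α, u ∉ P → m' P = m P) :
    ∀ (W : Finset α), u ∉ W → ursellOf m' W = ursellOf m W := by
  intro W
  induction W using Finset.strongInduction with
  | H W ih =>
    intro hu
    rw [ursellOf_eq, ursellOf_eq, h W hu]
    congr 1
    refine sum_congr rfl fun π hπ => prod_congr rfl fun P hP => ?_
    obtain ⟨hne, hπ'⟩ := mem_erase.1 hπ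
    have hsp := mem_setPartitions.1 hπ'
    exact ih P (hsp.ssubset_of_ne_singleton hne hP) fun huP => hu (hsp.subset hP huP)

/-- In a partition of `W ∋ u`, the blocks other than the block of `u` do not contain `u`, so a moment
function modified only on the sets containing `u` gives them the same Ursell functions. [folklore] -/
theorem prod_erase_blockOf_ursellOf_eq_of_forall_not_mem {W : Finset α} {π : Finset (Finset α)}
    (hsp : IsSetPartition W π) {u : α} (hu : u ∈ W) (m m' : Finset α → C)
    (h : ∀ P : Finset α, u ∉ P → m' P = m P) :
    ∏ P ∈ π.erase (blockOf π u), ursellOf m' P = ∏ P ∈ π.erase (blockOf π u), ursellOf m P := by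
  refine prod_congr rfl fun P hP => ?_
  obtain ⟨hPne, hPπ⟩ := mem_erase.1 hP
  refine ursellOf_eq_of_forall_not_mem m m' u h P fun huP => hPne ?_
  exact hsp.eq_of_mem hPπ (hsp.blockOf_mem hu) huP (hsp.mem_blockOf hu)

/-- **The Ursell function is linear in each argument** (Ruelle 1969, §4.4.2; Mastropietro 2008, §2.3):
if `m(P) = Σ_{k ∈ T} w_k m_k(P)` on the sets `P ∋ u` and every `m_k` agrees with `m` on the sets
`P ∌ u`, then `mᵀ(W) = Σ_{k ∈ T} w_k m_kᵀ(W)` for every `W ∋ u`. [cite: Ruelle1969, §4.4.2] -/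
theorem ursellOf_eq_sum_mul_of_linear {κ : Type*} (T : Finset κ) (w : κ → C)
    (m : Finset α → C) (mk : κ → Finset α → C) (u : α)
    (hoff : ∀ k ∈ T, ∀ P : Finset α, u ∉ P → mk k P = m P)
    (hon : ∀ P : Finset α, u ∈ P → m P = ∑ k ∈ T, w k * mk k P) :
    ∀ (W : Finset α), u ∈ W → ursellOf m W = ∑ k ∈ T, w k * ursellOf (mk k) W := by
  intro W
  induction W using Finset.strongInduction with
  | H W ih =>
    intro hu
    rw [ursellOf_eq, hon W hu]
    -- the proper partitions: pull out the block of `u` and use the induction hypothesis there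
    have hsum : ∑ π ∈ (setPartitions W).erase {W}, ∏ P ∈ π, ursellOf m P =
        ∑ k ∈ T, w k * ∑ π ∈ (setPartitions W).erase {W}, ∏ P ∈ π, ursellOf (mk k) P := by
      calc ∑ π ∈ (setPartitions W).erase {W}, ∏ P ∈ π, ursellOf m P
          = ∑ π ∈ (setPartitions W).erase {W}, ∑ k ∈ T,
              w k * (ursellOf (mk k) (blockOf π u) * ∏ P ∈ π.erase (blockOf π u), ursellOf (mk k) P) := by
            refine sum_congr rfl fun π hπ => ?_
            obtain ⟨hne, hπ'⟩ := mem_erase.1 hπ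
            have hsp := mem_setPartitions.1 hπ'
            have hP₀ : blockOf π u ∈ π := hsp.blockOf_mem hu
            have huP₀ : u ∈ blockOf π u := hsp.mem_blockOf hu
            rw [← mul_prod_erase π _ hP₀, ih _ (hsp.ssubset_of_ne_singleton hne hP₀) huP₀, sum_mul]
            refine sum_congr rfl fun k hk => ?_
            rw [prod_erase_blockOf_ursellOf_eq_of_forall_not_mem hsp hu m (mk k) (hoff k hk)]
            ring
        _ = ∑ k ∈ T, w k * ∑ π ∈ (setPartitions W).erase {W}, ∏ P ∈ π, ursellOf (mk k) P := by
            rw [sum_comm]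
            refine sum_congr rfl fun k hk => ?_
            rw [mul_sum]
            refine sum_congr rfl fun π hπ => ?_
            obtain ⟨-, hπ'⟩ := mem_erase.1 hπ
            have hsp := mem_setPartitions.1 hπ'
            rw [← mul_prod_erase π _ (hsp.blockOf_mem hu)]
    rw [hsum, ← sum_sub_distrib]
    refine sum_congr rfl fun k _ => ?_
    rw [ursellOf_eq, mul_sub]

/-- **Additivity in one argument**: if `m = m₁ + m₂` on the sets containing `u` and `m₁`, `m₂` agree
with `m` off `u`, then `mᵀ(W) = m₁ᵀ(W) + m₂ᵀ(W)` for `W ∋ u`. [cite: Ruelle1969, §4.4.2] -/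
theorem ursellOf_eq_add_of_linear (m m₁ m₂ : Finset α → C) (u : α)
    (h₁ : ∀ P : Finset α, u ∉ P → m₁ P = m P) (h₂ : ∀ P : Finset α, u ∉ P → m₂ P = m P)
    (hadd : ∀ P : Finset α, u ∈ P → m P = m₁ P + m₂ P) {W : Finset α} (hu : u ∈ W) :
    ursellOf m W = ursellOf m₁ W + ursellOf m₂ W := by
  have h := ursellOf_eq_sum_mul_of_linear (univ : Finset Bool) (fun _ => (1 : C)) m
    (fun b => if b then m₁ else m₂) u (fun b _ P hP => by cases b <;> simp [h₁ P hP, h₂ P hP])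
    (fun P hP => by simp [hadd P hP]) W hu
  simpa using h

/-- **Homogeneity in one argument**: if `m = s · m₁` on the sets containing `u` and `m₁` agrees with `m`
off `u`, then `mᵀ(W) = s · m₁ᵀ(W)` for `W ∋ u`. [cite: Ruelle1969, §4.4.2] -/
theorem ursellOf_eq_mul_of_linear (m m₁ : Finset α → C) (u : α) (s : C)
    (h₁ : ∀ P : Finset α, u ∉ P → m₁ P = m P) (hs : ∀ P : Finset α, u ∈ P → m P = s * m₁ P)
    {W : Finset α} (hu : u ∈ W) :
    ursellOf m W = s * ursellOf m₁ W := by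
  have h := ursellOf_eq_sum_mul_of_linear ({()} : Finset Unit) (fun _ => s) m (fun _ => m₁) u
    (fun _ _ P hP => h₁ P hP) (fun P hP => by simp [hs P hP]) W hu
  simpa using h

end Literature.Probability.LatticeModels
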